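import Mathlib.LinearAlgebra.Matrix.Charpoly.Coeff
import HarnessLib

/-!
# `det (M + diagonal d) = Σ_S (∏_{i ∉ S} dᵢ) · det M_S` — the principal-minor expansion of a diagonal shift

For a square matrix `M` over a commutative ring and a diagonal matrix `diagonal d`,

* `Literature.Analysis.Matrix.det_add_diagonal_eq_sum_minors` —
  **`det (M + diagonal d) = Σ_{S ⊆ n} (∏_{i ∉ S} d i) · det (M|_S)`**, the sum over all subsets of the
  index type of the principal minor of `M` on `S` times the product of the shifts off `S`
  (multilinearity of `det` in the rows: each row of `M + diagonal d` is the row of `M` plus `dᵢ`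
  times the `i`-th unit row);
* `Literature.Analysis.Matrix.det_sub_smul_one_eq_sum_minors` — the scalar case
  `det (M − ν·1) = Σ_S (−ν)^{|Sᶜ|} det (M|_S)` (equivalently the principal-minor formula for the
  coefficients of the characteristic polynomial, Mathlib's `Matrix.charpoly_coeff_eq_sum_minors`).

Use in the tree: "tadpole subtraction" in fermionic perturbation theory — the free expectation of a
product of shifted densities `∏ₐ (n_{oₐ}(tₐ) − dₐ)` is `det (G − diagonal d)` for the Wick/propagator
matrix `G` (Gaudin's rule gives `det G_S` for every sub-product), so the Dyson coefficients of an
interaction with counterterms `∏ (n − ν)` are determinants of the SHIFTED propagator matrix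
(Benfatto–Giuliani–Mastropietro 2006 §2; `Literature/MathematicalPhysics/QuantumLattice`).

Mathlib has the special case `d = X` (as a polynomial identity, `coeff_det_one_add_X_smul_eq_sum_minors`,
`charpoly_coeff_eq_sum_minors`) and the helper `det_piecewise_one_eq_submatrix_det`, on which the
proof below rests; the general diagonal shift is not in Mathlib. Everything is proved; no definitions.

## References

* R. A. Horn, C. R. Johnson, *Matrix Analysis* (2nd ed., 2013), §0.8.12 and Thm 1.2.16 (principal
  minor sums `E_k` and `det(tI + A)`); the diagonal (non-scalar) version is the same row-multilinearity
  argument. [folklore]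
-/

namespace Literature.Analysis.Matrix

open Finset
open _root_.Matrix

variable {R : Type*} [CommRing R] {n : Type*} [DecidableEq n] [Fintype n]

/-- **Principal-minor expansion of a diagonal shift**: for a square matrix `M` and `d : n → R`,
`det (M + diagonal d) = Σ_{S : Finset n} (∏_{i ∈ Sᶜ} d i) · det (M.submatrix (↑) (↑) : Matrix S S R)`.
(Row-multilinearity of the determinant: split every row into the row of `M` and `dᵢ eᵢ`; the term
indexed by the set `S` of rows taken from `M` is `∏_{i∉S} dᵢ` times the determinant of `M` with the
rows outside `S` replaced by unit rows, which is the principal minor on `S`.) Horn–Johnson §0.8.12.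
[folklore] -/
theorem det_add_diagonal_eq_sum_minors (M : Matrix n n R) (d : n → R) :
    (M + diagonal d).det =
      ∑ S : Finset n, (∏ i ∈ Sᶜ, d i) *
        (M.submatrix ((↑) : S → n) ((↑) : S → n) : Matrix S S R).det := by
  let D := (detRowAlternating : (n → R) [⋀^n]→ₗ[R] R)
  have hdet : ∀ A : Matrix n n R, A.det = D (fun i => A i) := fun A => rfl
  -- split every row: `(M + diagonal d) i = M i + (diagonal d) i`
  rw [hdet, show (fun i => (M + diagonal d) i) = (fun i => M i) + (fun i => (diagonal d) i) from rfl,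
    D.map_add_univ]
  refine Finset.sum_congr rfl fun S _ => ?_
  -- rows outside `S` are `d i • (unit row i)`
  have hrow : S.piecewise (fun i => M i) (fun i => (diagonal d) i) =
      fun i => (if i ∈ S then (1 : R) else d i) • S.piecewise (fun i => M i) (fun i => (1 : Matrix n n R) i) i := by
    funext i
    by_cases hi : i ∈ S
    · simp only [Finset.piecewise, if_pos hi, one_smul]
    · simp only [Finset.piecewise, if_neg hi]
      funext j
      simp only [Pi.smul_apply, smul_eq_mul, diagonal_apply, Matrix.one_apply, mul_ite, mul_one, mul_zero]
  rw [hrow, D.map_smul_univ, smul_eq_mul]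
  congr 1
  · rw [Finset.prod_ite, Finset.prod_const_one, one_mul]
    refine Finset.prod_congr ?_ fun _ _ => rfl
    ext i
    simp [Finset.mem_compl]
  · have h := Matrix.det_piecewise_one_eq_submatrix_det M S
    rw [← h]
    rfl

/-- **Scalar shift**: `det (M − ν·1) = Σ_{S : Finset n} (−ν)^{|Sᶜ|} · det (M.submatrix (↑) (↑) : Matrix S S R)`
— the principal-minor formula for `det(M − νI)` (the characteristic polynomial at `ν` up to sign;
cf. Mathlib's `Matrix.charpoly_coeff_eq_sum_minors`). Horn–Johnson Thm 1.2.16. [folklore] -/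
theorem det_sub_smul_one_eq_sum_minors (M : Matrix n n R) (ν : R) :
    (M - ν • (1 : Matrix n n R)).det =
      ∑ S : Finset n, (-ν) ^ Sᶜ.card *
        (M.submatrix ((↑) : S → n) ((↑) : S → n) : Matrix S S R).det := by
  have h1 : M - ν • (1 : Matrix n n R) = M + diagonal (fun _ => -ν) := by
    ext i j
    simp only [Matrix.sub_apply, Matrix.add_apply, Matrix.smul_apply, Matrix.one_apply, diagonal_apply,
      smul_eq_mul, mul_ite, mul_one, mul_zero]
    split_ifs <;> ring
  rw [h1, det_add_diagonal_eq_sum_minors]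
  refine Finset.sum_congr rfl fun S _ => ?_
  rw [Finset.prod_const]

end Literature.Analysis.Matrix
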